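import Literature.NumberTheory.Sieve.MaynardNFBilinear
import Literature.NumberTheory.Sieve.MaynardSieveLemma53
import HarnessLib

/-!
# The Maynard–Tao sieve over `𝓞_K`: `y^{(m)}` in terms of `y` (Castillo et al. Lemma 2.4 = Maynard's Lemma 5.3)

Topic `Literature/NumberTheory/Sieve`. A. Castillo, C. Hall, R. J. Lemke Oliver, P. Pollack,
L. Thompson, *Bounded gaps between primes in number fields and function fields*, Proc. AMS 143 (2015)
= arXiv:1403.5808, **Lemma 2.4** ("If `r_m = 1` then
`y^{(m)}_{𝔯₁,…,𝔯_k} = ∑_{𝔞_m} y_{𝔯₁,…,𝔯_{m−1},𝔞_m,𝔯_{m+1},…,𝔯_k}/φ(𝔞_m) + O(y_max φ(𝔴) log R/(|𝔴| D₀))`"),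
the number-field twin of J. Maynard, *Small gaps between primes*, Ann. of Math. 181 (2015),
Lemma 5.3, (5.27)–(5.31); this file is the port of the tree's `MaynardSieveLemma53.lean` (integers →
ideals, sizes → norms), everything PROVED:

* `hAF 𝔡 = μ(𝔡) N𝔡/φ(𝔡)`, `Vsum 𝔫 = ∑_{𝔢∣𝔫} hAF 𝔢` (`|Vsum 𝔫| = 1/φ(𝔫)` on squarefrees),
  `sum_filter_dvd_hAF_eq` (the divisor-interval sum `∑_{𝔲∣𝔡∣𝔯} hAF 𝔡 = hAF 𝔲 · Vsum(𝔯/𝔲)`);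
* `ym_eq_sum` — the exact identity (5.27)–(5.29) for `𝔲_m = (1)`;
* `kappa`, `Mterm`, `prefactor_mul_sum_main_eq` — the main term `κ(𝔲) M(𝔲)`,
  `M(𝔲) = ∑_𝔞 y_{𝔲[m↦𝔞]}/φ(𝔞)`, `κ(𝔲) = ∏_{i} g(𝔲ᵢ)N𝔲ᵢ/φ(𝔲ᵢ)²`;
* `abs_ym_sub_main_le` — **Lemma 2.4/5.3**: `|y^{(m)}_𝔲 − κ(𝔲)M(𝔲)| ≤ y_max κ(𝔲) · k L (Z − 1) Z^k`;
  `ym_eq_zero_of_ne`, `abs_Mterm_le`, `kappa_le_one`, `one_sub_le_kappa`.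

## References

* Castillo–Hall–Lemke Oliver–Pollack–Thompson, arXiv:1403.5808, Lemma 2.4. [CastilloEtAl2015]
* J. Maynard, *Small gaps between primes*, Ann. of Math. 181 (2015), Lemma 5.3. [MaynardAnnals2015]
-/

noncomputable section

open Finset UniqueFactorizationMonoid NumberField IsDedekindDomain
open scoped NumberField Classical

namespace Literature.NumberTheory.Sieve.MaynardNF

open Literature.NumberTheory.LFunctions Literature.NumberTheory.LFunctions.NumberField
  Literature.NumberTheory.Sieve.IdealSieve

variable {K : Type*} [Field K] [NumberField K]
variable {k : ℕ}

/-! ### The multiplicative function `h(𝔡) = μ(𝔡)N𝔡/φ(𝔡)` and `V(𝔫) = ∑_{𝔢∣𝔫} h(𝔢)` -/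

variable (K) in
/-- Maynard's auxiliary function `h(𝔡) = μ(𝔡) N𝔡/φ(𝔡)` over ideals (the summand of the `𝔡`-sum in
(5.28)). [cite: MaynardAnnals2015, (5.28)] -/
def hAF (𝔡 : Ideal (𝓞 K)) : ℝ := (idealMoebius 𝔡 : ℝ) * (Ideal.absNorm 𝔡 : ℝ) / idealTotient K 𝔡

/-- `h((1)) = 1`. [folklore] -/
theorem hAF_top : hAF K ⊤ = 1 := by
  rw [hAF, idealTotient_top, Ideal.absNorm_top]
  have : idealMoebius (⊤ : Ideal (𝓞 K)) = 1 := by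
    have hnf : normalizedFactors (⊤ : Ideal (𝓞 K)) = 0 := by
      rw [← Ideal.one_eq_top]; exact normalizedFactors_one
    have hsq : Squarefree (⊤ : Ideal (𝓞 K)) := by rw [← Ideal.one_eq_top]; exact squarefree_one
    rw [idealMoebius_apply_of_squarefree hsq, hnf]; simp
  rw [this]; simp

/-- `h` is multiplicative on comaximal ideals. [folklore] -/
theorem hAF_mul_of_coprime {𝔞 𝔟 : Ideal (𝓞 K)} (h : 𝔞 ⊔ 𝔟 = ⊤) :
    hAF K (𝔞 * 𝔟) = hAF K 𝔞 * hAF K 𝔟 := by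
  rw [hAF, hAF, hAF, idealMoebius_mul_of_coprime h, idealTotient_mul_of_coprime 𝔞 𝔟 h, map_mul]
  push_cast
  rw [div_mul_div_comm]
  ring

/-- `|h(𝔡)| = N𝔡/φ(𝔡)` for squarefree `𝔡`. [folklore] -/
theorem abs_hAF {𝔡 : Ideal (𝓞 K)} (hsq : Squarefree 𝔡) :
    |hAF K 𝔡| = (Ideal.absNorm 𝔡 : ℝ) / idealTotient K 𝔡 := by
  have h0 : 𝔡 ≠ ⊥ := by rw [Ne, ← Ideal.zero_eq_bot]; exact hsq.ne_zero
  rw [hAF, abs_div, abs_mul, abs_of_pos (idealTotient_pos h0), Nat.abs_cast]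
  have h1 : |(idealMoebius 𝔡 : ℝ)| = 1 := by
    have := idealMoebius_sq_of_squarefree (K := K) hsq
    have h2 : |(idealMoebius 𝔡 : ℝ)| ^ 2 = 1 := by rw [sq_abs, this]
    nlinarith [abs_nonneg (idealMoebius 𝔡 : ℝ)]
  rw [h1, one_mul]

variable (K) in
/-- `V(𝔫) = ∑_{𝔢 ∣ 𝔫} h(𝔢)`. [folklore] -/
def Vsum (𝔫 : Ideal (𝓞 K)) : ℝ := ∑ 𝔢 ∈ idealDivisors K 𝔫, hAF K 𝔢

/-- `V((1)) = 1`. [folklore] -/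
theorem Vsum_top : Vsum K ⊤ = 1 := by
  have hD : idealDivisors K (⊤ : Ideal (𝓞 K)) = {⊤} := by
    ext 𝔢
    rw [mem_idealDivisors top_ne_bot, Finset.mem_singleton]
    constructor
    · intro h
      exact (Ideal.isUnit_iff.1 (isUnit_of_dvd_one (by rwa [Ideal.one_eq_top])))
    · rintro rfl; exact dvd_rfl
  rw [Vsum, hD, Finset.sum_singleton, hAF_top]

/-- **`V(𝔫) = ∏_{P∣𝔫} (−1/(NP − 1))`** for squarefree `𝔫` (`h` is the multiplicative function with
`h(P) = −NP/(NP−1)`; apply `sum_divisors_ppMul`). [cite: MaynardAnnals2015, (5.29)] -/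
theorem Vsum_eq_prod {𝔫 : Ideal (𝓞 K)} (hsq : Squarefree 𝔫) :
    Vsum K 𝔫 = ∏ P ∈ (normalizedFactors 𝔫).toFinset, (-(1 / ((Ideal.absNorm P : ℝ) - 1))) := by
  have h𝔫0 : (𝔫 : Ideal (𝓞 K)) ≠ 0 := hsq.ne_zero
  have h𝔫 : 𝔫 ≠ ⊥ := by rwa [Ne, ← Ideal.zero_eq_bot]
  set b : Ideal (𝓞 K) → ℕ → ℝ := fun P j =>
    if j = 1 then -((Ideal.absNorm P : ℝ) / ((Ideal.absNorm P : ℝ) - 1)) else 0 with hb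
  -- `h(𝔢) = ppMul b 𝔢` on the (squarefree) divisors of `𝔫`
  have hppMul : ∀ 𝔢 ∈ idealDivisors K 𝔫, hAF K 𝔢 = ppMul b 𝔢 := by
    intro 𝔢 h𝔢
    have h𝔢0 := ne_bot_of_mem_idealDivisors h𝔫 h𝔢
    have h𝔢0' : (𝔢 : Ideal (𝓞 K)) ≠ 0 := by rwa [Ne, Ideal.zero_eq_bot]
    have hsq𝔢 : Squarefree 𝔢 := hsq.squarefree_of_dvd ((mem_idealDivisors h𝔫).1 h𝔢)
    have hnd := (squarefree_iff_nodup_normalizedFactors h𝔢0').1 hsq𝔢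
    have hcount : ∀ P ∈ (normalizedFactors 𝔢).toFinset, Multiset.count P (normalizedFactors 𝔢) = 1 := by
      intro P hP
      have := Multiset.nodup_iff_count_le_one.1 hnd P
      have := Multiset.one_le_count_iff_mem.2 (Multiset.mem_toFinset.1 hP)
      omega
    rw [ppMul, hAF, idealTotient_of_squarefree hsq𝔢, idealMoebius_apply_of_squarefree hsq𝔢,
      ← Multiset.toFinset_card_of_nodup hnd, Literature.NumberTheory.Sieve.IdealSieve.absNorm_eq_prod_pow h𝔢0]
    push_cast
    rw [Finset.prod_congr rfl fun P hP => by rw [hcount P hP, pow_one], ← Finset.prod_const,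
      ← Finset.prod_mul_distrib, ← Finset.prod_div_distrib]
    refine Finset.prod_congr rfl fun P hP => ?_
    rw [hb]; dsimp only
    rw [hcount P hP, if_pos rfl]
    ring
  rw [Vsum, Finset.sum_congr rfl hppMul, sum_divisors_ppMul b h𝔫 (fun 𝔡 => mem_idealDivisors h𝔫)]
  have hnd := (squarefree_iff_nodup_normalizedFactors h𝔫0).1 hsq
  refine Finset.prod_congr rfl fun P hP => ?_
  have hc : Multiset.count P (normalizedFactors 𝔫) = 1 := by
    have := Multiset.nodup_iff_count_le_one.1 hnd P
    have := Multiset.one_le_count_iff_mem.2 (Multiset.mem_toFinset.1 hP)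
    omega
  rw [hc]
  have h2 : (2 : ℝ) ≤ Ideal.absNorm P := by
    exact_mod_cast two_le_absNorm_of_prime (prime_of_normalized_factor P (Multiset.mem_toFinset.1 hP))
  have hP1 : (Ideal.absNorm P : ℝ) - 1 ≠ 0 := by linarith
  simp [Finset.sum_range_succ, hb]
  field_simp
  ring

/-- `|V(𝔫)| = 1/φ(𝔫)` for squarefree `𝔫`. [cite: MaynardAnnals2015, (5.29)] -/
theorem abs_Vsum {𝔫 : Ideal (𝓞 K)} (hsq : Squarefree 𝔫) : |Vsum K 𝔫| = 1 / idealTotient K 𝔫 := by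
  rw [Vsum_eq_prod hsq, Finset.abs_prod, idealTotient_of_squarefree hsq, one_div, ← Finset.prod_inv_distrib]
  refine Finset.prod_congr rfl fun P hP => ?_
  have h2 : (2 : ℝ) ≤ Ideal.absNorm P := by
    exact_mod_cast two_le_absNorm_of_prime (prime_of_normalized_factor P (Multiset.mem_toFinset.1 hP))
  rw [abs_neg, abs_of_pos (by apply one_div_pos.2; linarith), one_div]

/-- **The divisor-interval sum**: for `𝔯` squarefree and `𝔲 ∣ 𝔯`,
`∑_{𝔡 ∣ 𝔯, 𝔲 ∣ 𝔡} h(𝔡) = h(𝔲) V(𝔯/𝔲)` (`𝔡 = 𝔲𝔢`, `(𝔲, 𝔢) = 1`). [cite: MaynardAnnals2015, (5.28)–(5.29)] -/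
theorem sum_filter_dvd_hAF_eq {𝔲 𝔯 : Ideal (𝓞 K)} (hsq : Squarefree 𝔯) (hu : 𝔲 ∣ 𝔯) :
    ∑ 𝔡 ∈ (idealDivisors K 𝔯).filter (fun 𝔡 => 𝔲 ∣ 𝔡), hAF K 𝔡 = hAF K 𝔲 * Vsum K (cof 𝔲 𝔯) := by
  have h𝔯0 : (𝔯 : Ideal (𝓞 K)) ≠ 0 := hsq.ne_zero
  have h𝔯 : 𝔯 ≠ ⊥ := by rwa [Ne, ← Ideal.zero_eq_bot]
  set 𝔪 := cof 𝔲 𝔯 with h𝔪def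
  have h𝔯eq : 𝔯 = 𝔲 * 𝔪 := eq_mul_cof hu
  have h𝔲0 : 𝔲 ≠ 0 := by intro h; rw [h, zero_mul] at h𝔯eq; exact h𝔯0 h𝔯eq
  have h𝔪0 : 𝔪 ≠ 0 := by intro h; rw [h, mul_zero] at h𝔯eq; exact h𝔯0 h𝔯eq
  have h𝔪 : 𝔪 ≠ ⊥ := by rwa [Ne, ← Ideal.zero_eq_bot]
  have hcop : 𝔲 ⊔ 𝔪 = ⊤ := sup_eq_top_of_squarefree_mul (h𝔯eq ▸ hsq)
  have hset : (idealDivisors K 𝔯).filter (fun 𝔡 => 𝔲 ∣ 𝔡) = (idealDivisors K 𝔪).image (fun 𝔢 => 𝔲 * 𝔢) := by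
    ext 𝔡
    simp only [Finset.mem_filter, Finset.mem_image, mem_idealDivisors h𝔯, mem_idealDivisors h𝔪]
    constructor
    · rintro ⟨hd, ⟨𝔢, rfl⟩⟩
      refine ⟨𝔢, ?_, rfl⟩
      rw [h𝔯eq] at hd
      exact (mul_dvd_mul_iff_left h𝔲0).1 hd
    · rintro ⟨𝔢, he, rfl⟩
      rw [h𝔯eq]
      exact ⟨mul_dvd_mul_left 𝔲 he, dvd_mul_right _ _⟩
  rw [hset, Finset.sum_image fun 𝔢₁ _ 𝔢₂ _ h => mul_left_cancel₀ h𝔲0 h, Vsum, Finset.mul_sum]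
  refine Finset.sum_congr rfl fun 𝔢 he => ?_
  refine hAF_mul_of_coprime ?_
  rw [eq_top_iff, ← hcop]
  exact sup_le_sup_left (Ideal.le_of_dvd ((mem_idealDivisors h𝔪).1 he)) _

/-! ### Lemma 5.3, exact form -/

variable {𝔴 : Ideal (𝓞 K)} {B : ℝ} {y : (Fin k → Ideal (𝓞 K)) → ℝ} {m : Fin k}

/-- Unfolding `ym`. [folklore] -/
theorem ym_def (𝔲 : Fin k → Ideal (𝓞 K)) :
    ym K k 𝔴 B y m 𝔲 = (∏ i, (idealMoebius (𝔲 i) : ℝ) * gId K (𝔲 i)) *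
      ∑ 𝔡 ∈ (boxG K k 𝔴 B).filter (fun 𝔡 => ∀ i, 𝔲 i ∣ 𝔡 i),
        lamM K k B y m 𝔡 / ∏ i, idealTotient K (𝔡 i) := rfl

/-- `λ^{(m)}_𝔡/∏φ(𝔡ᵢ) = [𝔡_m = (1)] (∏ h(𝔡ᵢ)) ∑_{𝔡∣𝔯} y_𝔯/∏φ(𝔯ᵢ)`. [folklore] -/
theorem lamM_div_prod_eq (𝔡 : Fin k → Ideal (𝓞 K)) :
    lamM K k B y m 𝔡 / ∏ i, idealTotient K (𝔡 i) =
      if 𝔡 m = ⊤ then (∏ i, hAF K (𝔡 i)) *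
        ∑ 𝔯 ∈ (box K k B).filter (fun 𝔯 => ∀ i, 𝔡 i ∣ 𝔯 i), y 𝔯 / ∏ i, idealTotient K (𝔯 i) else 0 := by
  rw [lamM_def]
  split_ifs with hm
  · rw [lam_def, mul_div_right_comm]
    congr 1
    rw [← Finset.prod_div_distrib]
    rfl
  · rw [zero_div]

/-- The `𝔡`-range of Lemma 5.3 (for `𝔲_m = (1)` and `𝔯` in the box): the tuples `𝔡` of the box with
`𝔲 ∣ 𝔡 ∣ 𝔯` and `𝔡_m = (1)` form the product of `{(1)}` (slot `m`) with the divisor intervals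
`{𝔫 : 𝔲ᵢ ∣ 𝔫 ∣ 𝔯ᵢ}`. [folklore] -/
theorem filter_box_slot_eq {𝔲 𝔯 : Fin k → Ideal (𝓞 K)} (hum : 𝔲 m = ⊤) (hr : 𝔯 ∈ box K k B) :
    (box K k B).filter (fun 𝔡 => (∀ i, 𝔲 i ∣ 𝔡 i) ∧ 𝔡 m = ⊤ ∧ ∀ i, 𝔡 i ∣ 𝔯 i) =
      Fintype.piFinset fun i => if i = m then ({⊤} : Finset (Ideal (𝓞 K)))
        else (idealDivisors K (𝔯 i)).filter (fun 𝔫 => 𝔲 i ∣ 𝔫) := by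
  rw [mem_box_iff] at hr
  ext 𝔡
  simp only [Finset.mem_filter, mem_box_iff, Fintype.mem_piFinset]
  constructor
  · rintro ⟨hbox, hud, hdm, hdr⟩ i
    by_cases hi : i = m
    · subst hi; simp [hdm]
    · rw [if_neg hi, Finset.mem_filter, mem_idealDivisors (hr i).1]
      exact ⟨hdr i, hud i⟩
  · intro h
    have hdm : 𝔡 m = ⊤ := by have := h m; simpa using this
    have hrest : ∀ i, i ≠ m → 𝔡 i ∣ 𝔯 i ∧ 𝔲 i ∣ 𝔡 i := fun i hi => by
      have := h i
      rw [if_neg hi, Finset.mem_filter, mem_idealDivisors (hr i).1] at this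
      exact this
    have hdr : ∀ i, 𝔡 i ∣ 𝔯 i := fun i => by
      by_cases hi : i = m
      · subst hi; rw [hdm, ← Ideal.one_eq_top]; exact one_dvd _
      · exact (hrest i hi).1
    have hd0 : ∀ i, 𝔡 i ≠ ⊥ := fun i h0 => by
      have := hdr i
      rw [h0, Ideal.dvd_iff_le, le_bot_iff] at this
      exact (hr i).1 this
    refine ⟨fun i => ⟨hd0 i, ?_⟩, fun i => ?_, hdm, hdr⟩
    · have hN0 : Ideal.absNorm (𝔯 i) ≠ 0 := by rw [Ne, Ideal.absNorm_eq_zero_iff]; exact (hr i).1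
      calc (Ideal.absNorm (𝔡 i) : ℝ) ≤ Ideal.absNorm (𝔯 i) := by
            exact_mod_cast Nat.le_of_dvd (Nat.pos_of_ne_zero hN0) (map_dvd _ (hdr i))
        _ ≤ B := (hr i).2
    · by_cases hi : i = m
      · subst hi; rw [hum, ← Ideal.one_eq_top]; exact one_dvd _
      · exact (hrest i hi).2

/-- The local factor of the `𝔡`-sum: `∑_{𝔲ᵢ ∣ 𝔫 ∣ 𝔯ᵢ} h(𝔫) = [𝔲ᵢ ∣ 𝔯ᵢ] h(𝔲ᵢ) V(𝔯ᵢ/𝔲ᵢ)` for `𝔯ᵢ`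
squarefree. [folklore] -/
theorem sum_filter_divisors_hAF_eq {𝔞 𝔫 : Ideal (𝓞 K)} (hn : Squarefree 𝔫) :
    ∑ 𝔢 ∈ (idealDivisors K 𝔫).filter (fun 𝔢 => 𝔞 ∣ 𝔢), hAF K 𝔢 =
      if 𝔞 ∣ 𝔫 then hAF K 𝔞 * Vsum K (cof 𝔞 𝔫) else 0 := by
  split_ifs with h
  · exact sum_filter_dvd_hAF_eq hn h
  · have hn0 : 𝔫 ≠ ⊥ := by rw [Ne, ← Ideal.zero_eq_bot]; exact hn.ne_zero
    refine Finset.sum_eq_zero fun 𝔢 he => ?_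
    rw [Finset.mem_filter, mem_idealDivisors hn0] at he
    exact absurd (dvd_trans he.2 he.1) h

/-- **Lemma 5.3 / 2.4, exact form.** For `y` supported on good tuples and `𝔲_m = (1)`:
`y^{(m)}_𝔲 = (∏ μ(𝔲ᵢ)g(𝔲ᵢ)) ∑_{𝔯 good} (y_𝔯/∏φ(𝔯ᵢ)) ∏_{i ≠ m} [𝔲ᵢ ∣ 𝔯ᵢ] h(𝔲ᵢ) V(𝔯ᵢ/𝔲ᵢ)`
(substitute the definition of `λ` into that of `y^{(m)}`, swap the `𝔡`- and `𝔯`-sums and evaluate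
the `𝔡`-sum). [cite: CastilloEtAl2015, Lemma 2.4; MaynardAnnals2015, (5.27)–(5.29)] -/
theorem ym_eq_sum (hy : SupportedOn K k 𝔴 B y) {𝔲 : Fin k → Ideal (𝓞 K)} (hum : 𝔲 m = ⊤) :
    ym K k 𝔴 B y m 𝔲 = (∏ i, (idealMoebius (𝔲 i) : ℝ) * gId K (𝔲 i)) *
      ∑ 𝔯 ∈ boxG K k 𝔴 B, (y 𝔯 / ∏ i, idealTotient K (𝔯 i)) *
        ∏ i ∈ Finset.univ.erase m,
          (if 𝔲 i ∣ 𝔯 i then hAF K (𝔲 i) * Vsum K (cof (𝔲 i) (𝔯 i)) else 0) := by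
  rw [ym_def]
  congr 1
  -- Step 1: the `𝔡`-sum over good tuples equals the `𝔡`-sum over the box, with `lamM` unfolded.
  have step1 : ∑ 𝔡 ∈ (boxG K k 𝔴 B).filter (fun 𝔡 => ∀ i, 𝔲 i ∣ 𝔡 i),
      lamM K k B y m 𝔡 / ∏ i, idealTotient K (𝔡 i) =
      ∑ 𝔡 ∈ (box K k B).filter (fun 𝔡 => (∀ i, 𝔲 i ∣ 𝔡 i) ∧ 𝔡 m = ⊤),
        (∏ i, hAF K (𝔡 i)) * ∑ 𝔯 ∈ (box K k B).filter (fun 𝔯 => ∀ i, 𝔡 i ∣ 𝔯 i),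
          y 𝔯 / ∏ i, idealTotient K (𝔯 i) := by
    rw [Finset.sum_filter, Finset.sum_filter]
    have hext : ∑ 𝔡 ∈ boxG K k 𝔴 B, (if (∀ i, 𝔲 i ∣ 𝔡 i) then
        lamM K k B y m 𝔡 / ∏ i, idealTotient K (𝔡 i) else 0) =
        ∑ 𝔡 ∈ box K k B, (if (∀ i, 𝔲 i ∣ 𝔡 i) then
          lamM K k B y m 𝔡 / ∏ i, idealTotient K (𝔡 i) else 0) := by
      refine Finset.sum_subset (fun 𝔡 hd => (mem_boxG.1 hd).1) fun 𝔡 _ hnd => ?_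
      split_ifs
      · rw [lamM_def]
        split_ifs
        · rw [lam_eq_zero_of_not hy hnd, zero_div]
        · rw [zero_div]
      · rfl
    rw [hext]
    refine Finset.sum_congr rfl fun 𝔡 _ => ?_
    by_cases h1 : ∀ i, 𝔲 i ∣ 𝔡 i
    · rw [if_pos h1, lamM_div_prod_eq]
      by_cases h2 : 𝔡 m = ⊤
      · rw [if_pos h2, if_pos ⟨h1, h2⟩]
      · rw [if_neg h2, if_neg (fun h => h2 h.2)]
    · rw [if_neg h1, if_neg (fun h => h1 h.1)]
  rw [step1]
  -- Step 2: swap the `𝔡`- and `𝔯`-sums.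
  have step2 : ∑ 𝔡 ∈ (box K k B).filter (fun 𝔡 => (∀ i, 𝔲 i ∣ 𝔡 i) ∧ 𝔡 m = ⊤),
      (∏ i, hAF K (𝔡 i)) * ∑ 𝔯 ∈ (box K k B).filter (fun 𝔯 => ∀ i, 𝔡 i ∣ 𝔯 i),
        y 𝔯 / ∏ i, idealTotient K (𝔯 i) =
      ∑ 𝔯 ∈ box K k B, (y 𝔯 / ∏ i, idealTotient K (𝔯 i)) *
        ∑ 𝔡 ∈ (box K k B).filter (fun 𝔡 => (∀ i, 𝔲 i ∣ 𝔡 i) ∧ 𝔡 m = ⊤ ∧ ∀ i, 𝔡 i ∣ 𝔯 i),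
          ∏ i, hAF K (𝔡 i) := by
    calc _ = ∑ 𝔡 ∈ box K k B, ∑ 𝔯 ∈ box K k B,
          (if ((∀ i, 𝔲 i ∣ 𝔡 i) ∧ 𝔡 m = ⊤) ∧ (∀ i, 𝔡 i ∣ 𝔯 i) then
            (∏ i, hAF K (𝔡 i)) * (y 𝔯 / ∏ i, idealTotient K (𝔯 i)) else 0) := by
          rw [Finset.sum_filter]
          refine Finset.sum_congr rfl fun 𝔡 _ => ?_
          rw [Finset.mul_sum, Finset.sum_filter]
          split_ifs with h1
          · refine Finset.sum_congr rfl fun 𝔯 _ => ?_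
            by_cases h2 : ∀ i, 𝔡 i ∣ 𝔯 i
            · rw [if_pos h2, if_pos ⟨h1, h2⟩]
            · rw [if_neg h2, if_neg (fun h => h2 h.2)]
          · symm
            refine Finset.sum_eq_zero fun 𝔯 _ => ?_
            rw [if_neg (fun h => h1 h.1)]
      _ = ∑ 𝔯 ∈ box K k B, ∑ 𝔡 ∈ box K k B,
          (if ((∀ i, 𝔲 i ∣ 𝔡 i) ∧ 𝔡 m = ⊤) ∧ (∀ i, 𝔡 i ∣ 𝔯 i) then
            (∏ i, hAF K (𝔡 i)) * (y 𝔯 / ∏ i, idealTotient K (𝔯 i)) else 0) := Finset.sum_comm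
      _ = _ := by
          refine Finset.sum_congr rfl fun 𝔯 _ => ?_
          rw [Finset.mul_sum, Finset.sum_filter]
          refine Finset.sum_congr rfl fun 𝔡 _ => ?_
          by_cases h : (∀ i, 𝔲 i ∣ 𝔡 i) ∧ 𝔡 m = ⊤ ∧ ∀ i, 𝔡 i ∣ 𝔯 i
          · rw [if_pos h, if_pos ⟨⟨h.1, h.2.1⟩, h.2.2⟩]; ring
          · rw [if_neg h, if_neg (fun h' => h ⟨h'.1.1, h'.1.2, h'.2⟩)]
  rw [step2]
  -- Step 3: restrict to good `𝔯` (`y_𝔯 = 0` otherwise) and evaluate the `𝔡`-sum.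
  symm
  refine Finset.sum_subset (fun 𝔯 hr => (mem_boxG.1 hr).1) (fun 𝔯 hr hnr => ?_) |>.trans ?_
  · have : y 𝔯 = 0 := by
      by_contra h
      exact hnr (mem_boxG.2 ⟨hr, (hy 𝔯 h).2⟩)
    rw [this, zero_div, zero_mul]
  refine Finset.sum_congr rfl fun 𝔯 hr => ?_
  by_cases hyr : y 𝔯 = 0
  · rw [hyr, zero_div, zero_mul, zero_mul]
  have hrg : 𝔯 ∈ boxG K k 𝔴 B := mem_boxG.2 ⟨hr, (hy 𝔯 hyr).2⟩
  congr 1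
  rw [filter_box_slot_eq hum hr, ← Finset.prod_univ_sum (fun i => if i = m then ({⊤} : Finset (Ideal (𝓞 K)))
    else (idealDivisors K (𝔯 i)).filter (fun 𝔫 => 𝔲 i ∣ 𝔫)) (fun _ 𝔫 => hAF K 𝔫),
    ← Finset.mul_prod_erase _ _ (Finset.mem_univ m)]
  rw [if_pos rfl, Finset.sum_singleton, hAF_top, one_mul]
  refine Finset.prod_congr rfl fun i hi => ?_
  rw [Finset.mem_erase] at hi
  rw [if_neg hi.1, sum_filter_divisors_hAF_eq ((mem_boxG.1 hrg).2.squarefree_apply i)]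

/-! ### The main term `κ(𝔲) M(𝔲)` -/

/-- `cof 𝔲 𝔲 = (1)` for `𝔲 ≠ 0`. [folklore] -/
theorem cof_self {𝔲 : Ideal (𝓞 K)} (h : 𝔲 ≠ ⊥) : cof 𝔲 𝔲 = ⊤ := by
  have h0 : (𝔲 : Ideal (𝓞 K)) ≠ 0 := by rwa [Ne, Ideal.zero_eq_bot]
  have := eq_mul_cof (dvd_refl 𝔲)
  rw [← Ideal.one_eq_top]
  exact (mul_eq_left₀ h0).1 this.symm

omit [NumberField K] in
/-- `cof (1) 𝔯 = 𝔯`. [folklore] -/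
theorem cof_top (𝔯 : Ideal (𝓞 K)) : cof ⊤ 𝔯 = 𝔯 := by
  have := eq_mul_cof (show (⊤ : Ideal (𝓞 K)) ∣ 𝔯 from ⟨𝔯, (Ideal.top_mul 𝔯).symm⟩)
  rw [Ideal.top_mul] at this
  exact this.symm

variable (K) in
/-- Maynard's factor `κ(𝔲) = ∏ᵢ g(𝔲ᵢ) N𝔲ᵢ/φ(𝔲ᵢ)²` (`= ∏_{P ∣ ∏𝔲ᵢ} (NP−2)NP/(NP−1)² = 1 + O(D₀⁻¹)`,
the product in (5.31)). [cite: MaynardAnnals2015, (5.31)] -/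
def kappa (𝔲 : Fin k → Ideal (𝓞 K)) : ℝ :=
  ∏ i, gId K (𝔲 i) * (Ideal.absNorm (𝔲 i) : ℝ) / idealTotient K (𝔲 i) ^ 2

variable (K) in
/-- The slot-`m` sum `M(𝔲) = ∑_{0 < N𝔞 ≤ B} y_{𝔲[m ↦ 𝔞]}/φ(𝔞)` (the main term of Lemma 2.4/5.3).
[cite: CastilloEtAl2015, Lemma 2.4] -/
def Mterm (B : ℝ) (y : (Fin k → Ideal (𝓞 K)) → ℝ) (m : Fin k) (𝔲 : Fin k → Ideal (𝓞 K)) : ℝ :=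
  ∑ 𝔞 ∈ idealsLE K B, y (Function.update 𝔲 m 𝔞) / idealTotient K 𝔞

/-- The prefactor has absolute value `∏ g(𝔲ᵢ)` on good `𝔲` (when the primes of norm `2` divide `𝔴`).
[folklore] -/
theorem abs_prefactor_eq (h2 : ∀ P : Ideal (𝓞 K), Prime P → Ideal.absNorm P = 2 → P ∣ 𝔴)
    {𝔲 : Fin k → Ideal (𝓞 K)} (hu : 𝔲 ∈ boxG K k 𝔴 B) :
    |∏ i, (idealMoebius (𝔲 i) : ℝ) * gId K (𝔲 i)| = ∏ i, gId K (𝔲 i) := by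
  rw [Finset.abs_prod]
  refine Finset.prod_congr rfl fun i _ => ?_
  have hG := apply_mem_G1_of_mem_boxG hu i
  rw [abs_mul, abs_of_pos (gId_pos_of_mem_G1 h2 hG)]
  have h1 : |(idealMoebius (𝔲 i) : ℝ)| = 1 := by
    have := idealMoebius_sq_of_squarefree (K := K) (mem_G1.1 hG).2.1
    have hsq : |(idealMoebius (𝔲 i) : ℝ)| ^ 2 = 1 := by rw [sq_abs, this]
    nlinarith [abs_nonneg (idealMoebius (𝔲 i) : ℝ)]
  rw [h1, one_mul]

/-- `κ(𝔲) > 0` for good `𝔲` (primes of norm `2` dividing `𝔴`). [folklore] -/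
theorem kappa_pos (h2 : ∀ P : Ideal (𝓞 K), Prime P → Ideal.absNorm P = 2 → P ∣ 𝔴)
    {𝔲 : Fin k → Ideal (𝓞 K)} (hu : 𝔲 ∈ boxG K k 𝔴 B) : 0 < kappa K 𝔲 := by
  unfold kappa
  refine Finset.prod_pos fun i _ => ?_
  have hG := apply_mem_G1_of_mem_boxG hu i
  exact div_pos (mul_pos (gId_pos_of_mem_G1 h2 hG) (normR_pos_of_mem_G1 hG))
    (pow_pos (idealTotient_pos_of_mem_G1 hG) 2)

/-- **The main term of Lemma 2.4/5.3**: the tuples `𝔯` with `𝔯ᵢ = 𝔲ᵢ` for `i ≠ m` contribute exactly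
`κ(𝔲) · ∑_𝔞 y_{𝔲[m↦𝔞]}/φ(𝔞)` (Maynard (5.31) without its error term).
[cite: CastilloEtAl2015, Lemma 2.4; MaynardAnnals2015, (5.31)] -/
theorem prefactor_mul_sum_main_eq (hy : SupportedOn K k 𝔴 B y) {𝔲 : Fin k → Ideal (𝓞 K)}
    (hu : 𝔲 ∈ boxG K k 𝔴 B) (hum : 𝔲 m = ⊤) :
    (∏ i, (idealMoebius (𝔲 i) : ℝ) * gId K (𝔲 i)) *
      ∑ 𝔯 ∈ (boxG K k 𝔴 B).filter (fun 𝔯 => ∀ i, i ≠ m → 𝔯 i = 𝔲 i),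
        (y 𝔯 / ∏ i, idealTotient K (𝔯 i)) *
          ∏ i ∈ Finset.univ.erase m,
            (if 𝔲 i ∣ 𝔯 i then hAF K (𝔲 i) * Vsum K (cof (𝔲 i) (𝔯 i)) else 0) =
      kappa K 𝔲 * Mterm K B y m 𝔲 := by
  have huG := apply_mem_G1_of_mem_boxG hu
  -- the value of each main summand
  have hterm : ∀ 𝔯 ∈ (boxG K k 𝔴 B).filter (fun 𝔯 => ∀ i, i ≠ m → 𝔯 i = 𝔲 i),
      (∏ i, (idealMoebius (𝔲 i) : ℝ) * gId K (𝔲 i)) *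
        ((y 𝔯 / ∏ i, idealTotient K (𝔯 i)) *
          ∏ i ∈ Finset.univ.erase m,
            (if 𝔲 i ∣ 𝔯 i then hAF K (𝔲 i) * Vsum K (cof (𝔲 i) (𝔯 i)) else 0)) =
        kappa K 𝔲 * (y 𝔯 / idealTotient K (𝔯 m)) := by
    intro 𝔯 hr
    rw [Finset.mem_filter] at hr
    obtain ⟨hrg, hru⟩ := hr
    have hc : ∀ i ∈ Finset.univ.erase m,
        (if 𝔲 i ∣ 𝔯 i then hAF K (𝔲 i) * Vsum K (cof (𝔲 i) (𝔯 i)) else 0) = hAF K (𝔲 i) := by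
      intro i hi
      rw [Finset.mem_erase] at hi
      have hri : 𝔯 i = 𝔲 i := hru i hi.1
      rw [if_pos (hri ▸ dvd_rfl), hri, cof_self (mem_G1.1 (huG i)).1.1, Vsum_top, mul_one]
    rw [Finset.prod_congr rfl hc]
    have hφ : (∏ i, idealTotient K (𝔯 i)) = idealTotient K (𝔯 m) *
        ∏ i ∈ Finset.univ.erase m, idealTotient K (𝔲 i) := by
      rw [← Finset.mul_prod_erase _ _ (Finset.mem_univ m)]
      congr 1
      exact Finset.prod_congr rfl fun i hi => by rw [hru i (Finset.mem_erase.1 hi).1]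
    have hP : (∏ i, (idealMoebius (𝔲 i) : ℝ) * gId K (𝔲 i)) =
        ∏ i ∈ Finset.univ.erase m, (idealMoebius (𝔲 i) : ℝ) * gId K (𝔲 i) := by
      rw [← Finset.mul_prod_erase _ _ (Finset.mem_univ m), hum, gId_top]
      have : idealMoebius (⊤ : Ideal (𝓞 K)) = 1 := by
        have hnf : normalizedFactors (⊤ : Ideal (𝓞 K)) = 0 := by
          rw [← Ideal.one_eq_top]; exact normalizedFactors_one
        have hsq : Squarefree (⊤ : Ideal (𝓞 K)) := by rw [← Ideal.one_eq_top]; exact squarefree_one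
        rw [idealMoebius_apply_of_squarefree hsq, hnf]; simp
      rw [this]; simp
    have hκ : kappa K 𝔲 = ∏ i ∈ Finset.univ.erase m,
        gId K (𝔲 i) * (Ideal.absNorm (𝔲 i) : ℝ) / idealTotient K (𝔲 i) ^ 2 := by
      rw [kappa, ← Finset.mul_prod_erase _ _ (Finset.mem_univ m), hum, gId_top, idealTotient_top,
        Ideal.absNorm_top]
      simp
    have hφ0 : ∀ i, idealTotient K (𝔲 i) ≠ 0 := fun i => (idealTotient_pos_of_mem_G1 (huG i)).ne'
    have hrm0 : idealTotient K (𝔯 m) ≠ 0 :=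
      (idealTotient_pos_of_mem_G1 (apply_mem_G1_of_mem_boxG hrg m)).ne'
    rw [hφ, hP, hκ]
    have hloc : ∀ i ∈ Finset.univ.erase m,
        (idealMoebius (𝔲 i) : ℝ) * gId K (𝔲 i) * hAF K (𝔲 i) / idealTotient K (𝔲 i) =
          gId K (𝔲 i) * (Ideal.absNorm (𝔲 i) : ℝ) / idealTotient K (𝔲 i) ^ 2 := by
      intro i _
      have hμ2 : (idealMoebius (𝔲 i) : ℝ) * (idealMoebius (𝔲 i) : ℝ) = 1 := by
        rw [← sq]; exact idealMoebius_sq_of_squarefree (mem_G1.1 (huG i)).2.1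
      rw [hAF]
      have : (idealMoebius (𝔲 i) : ℝ) * gId K (𝔲 i) *
          ((idealMoebius (𝔲 i) : ℝ) * (Ideal.absNorm (𝔲 i) : ℝ) / idealTotient K (𝔲 i)) /
            idealTotient K (𝔲 i) =
          ((idealMoebius (𝔲 i) : ℝ) * (idealMoebius (𝔲 i) : ℝ)) *
            (gId K (𝔲 i) * (Ideal.absNorm (𝔲 i) : ℝ) / idealTotient K (𝔲 i) ^ 2) := by
        ring
      rw [this, hμ2, one_mul]
    calc (∏ i ∈ Finset.univ.erase m, (idealMoebius (𝔲 i) : ℝ) * gId K (𝔲 i)) *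
          (y 𝔯 / (idealTotient K (𝔯 m) * ∏ i ∈ Finset.univ.erase m, idealTotient K (𝔲 i)) *
            ∏ i ∈ Finset.univ.erase m, hAF K (𝔲 i))
        = (∏ i ∈ Finset.univ.erase m,
            (idealMoebius (𝔲 i) : ℝ) * gId K (𝔲 i) * hAF K (𝔲 i) / idealTotient K (𝔲 i)) *
            (y 𝔯 / idealTotient K (𝔯 m)) := by
          rw [Finset.prod_div_distrib, Finset.prod_mul_distrib, Finset.prod_mul_distrib,
            Finset.prod_mul_distrib]
          have hprod : (∏ i ∈ Finset.univ.erase m, idealTotient K (𝔲 i)) ≠ 0 :=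
            Finset.prod_ne_zero_iff.2 fun i _ => hφ0 i
          field_simp
      _ = _ := by rw [Finset.prod_congr rfl hloc]
  rw [Finset.mul_sum, Finset.sum_congr rfl hterm, ← Finset.mul_sum]
  congr 1
  -- the main `𝔯` range is the image of `𝔞 ↦ 𝔲[m ↦ 𝔞]`
  rw [Mterm]
  have hinj : Set.InjOn (Function.update 𝔲 m) (idealsLE K B : Set (Ideal (𝓞 K))) := by
    intro a _ b _ h
    have := congrFun h m
    simpa using this
  have hrhs : ∑ 𝔞 ∈ idealsLE K B, y (Function.update 𝔲 m 𝔞) / idealTotient K 𝔞 =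
      ∑ 𝔞 ∈ idealsLE K B, (fun 𝔯 => y 𝔯 / idealTotient K (𝔯 m)) (Function.update 𝔲 m 𝔞) := by
    refine Finset.sum_congr rfl fun 𝔞 _ => ?_
    simp
  rw [hrhs, ← Finset.sum_image (f := fun 𝔯 => y 𝔯 / idealTotient K (𝔯 m)) hinj]
  refine Finset.sum_subset (fun 𝔯 hr => ?_) fun 𝔯 hr hnr => ?_
  · rw [Finset.mem_filter] at hr
    rw [Finset.mem_image]
    refine ⟨𝔯 m, ?_, ?_⟩
    · have := (mem_box_iff.1 (mem_boxG.1 hr.1).1) m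
      exact mem_idealsLE.2 this
    · funext i
      by_cases hi : i = m
      · subst hi; simp
      · rw [Function.update_of_ne hi, hr.2 i hi]
  · rw [Finset.mem_image] at hr
    obtain ⟨𝔞, _, rfl⟩ := hr
    have : y (Function.update 𝔲 m 𝔞) = 0 := by
      by_contra h
      apply hnr
      rw [Finset.mem_filter]
      refine ⟨mem_boxG.2 ⟨(hy _ h).1, (hy _ h).2⟩, fun i hi => ?_⟩
      rw [Function.update_of_ne hi]
    simp only [this, zero_div]

/-! ### The error terms -/

/-- The weight of the error terms of Lemma 2.4/5.3: `w(𝔱) = (1/φ(𝔱_m)) ∏_{i ≠ m} 1/φ(𝔱ᵢ)²`. [folklore] -/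
def wfun (m : Fin k) (𝔱 : Fin k → Ideal (𝓞 K)) : ℝ :=
  (1 / idealTotient K (𝔱 m)) * ∏ i ∈ Finset.univ.erase m, 1 / idealTotient K (𝔱 i) ^ 2

/-- `w ≥ 0` on tuples of nonzero ideals. [folklore] -/
theorem wfun_nonneg (m : Fin k) {𝔱 : Fin k → Ideal (𝓞 K)} (h : ∀ i, 𝔱 i ≠ ⊥) : 0 ≤ wfun (K := K) m 𝔱 := by
  unfold wfun
  refine mul_nonneg (one_div_pos.2 (idealTotient_pos (h m))).le (Finset.prod_nonneg fun i _ => ?_)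
  positivity

/-- **The error terms of Lemma 2.4/5.3, termwise** (Maynard (5.30)): for good `𝔲` with `𝔲_m = (1)`
and a good `𝔯`,
`|∏μ(𝔲ᵢ)g(𝔲ᵢ)| · |y_𝔯/∏φ(𝔯ᵢ)| · ∏_{i≠m} |[𝔲ᵢ∣𝔯ᵢ] h(𝔲ᵢ)V(𝔯ᵢ/𝔲ᵢ)| ≤ y_max κ(𝔲) w(𝔯/𝔲)` (and `= 0`
unless `𝔲 ∣ 𝔯`). [cite: MaynardAnnals2015, (5.30)] -/
theorem abs_rest_term_le (h2 : ∀ P : Ideal (𝓞 K), Prime P → Ideal.absNorm P = 2 → P ∣ 𝔴)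
    {𝔲 : Fin k → Ideal (𝓞 K)} (hu : 𝔲 ∈ boxG K k 𝔴 B) (hum : 𝔲 m = ⊤)
    {ymax : ℝ} (hymax : ∀ 𝔯, |y 𝔯| ≤ ymax) {𝔯 : Fin k → Ideal (𝓞 K)} (hr : 𝔯 ∈ boxG K k 𝔴 B) :
    |(∏ i, (idealMoebius (𝔲 i) : ℝ) * gId K (𝔲 i)) *
        ((y 𝔯 / ∏ i, idealTotient K (𝔯 i)) *
          ∏ i ∈ Finset.univ.erase m,
            (if 𝔲 i ∣ 𝔯 i then hAF K (𝔲 i) * Vsum K (cof (𝔲 i) (𝔯 i)) else 0))| ≤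
      ymax * kappa K 𝔲 * (if ∀ i, 𝔲 i ∣ 𝔯 i then wfun m (fun i => cof (𝔲 i) (𝔯 i)) else 0) := by
  have huG := apply_mem_G1_of_mem_boxG hu
  have hrG := apply_mem_G1_of_mem_boxG hr
  have hy0 : 0 ≤ ymax := le_trans (abs_nonneg _) (hymax 𝔯)
  have hκ := kappa_pos h2 hu
  by_cases hdiv : ∀ i, 𝔲 i ∣ 𝔯 i
  swap
  · rw [if_neg hdiv]
    obtain ⟨i, hi⟩ := not_forall.1 hdiv
    have him : i ≠ m := fun h => hi (by rw [h, hum, ← Ideal.one_eq_top]; exact one_dvd _)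
    rw [Finset.prod_eq_zero (Finset.mem_erase.2 ⟨him, Finset.mem_univ i⟩) (if_neg hi)]
    simp
  rw [if_pos hdiv]
  -- write `𝔯ᵢ = 𝔲ᵢ 𝔱ᵢ`
  set t : Fin k → Ideal (𝓞 K) := fun i => cof (𝔲 i) (𝔯 i) with ht
  have hrt : ∀ i, 𝔯 i = 𝔲 i * t i := fun i => eq_mul_cof (hdiv i)
  have hcop : ∀ i, 𝔲 i ⊔ t i = ⊤ := fun i =>
    sup_eq_top_of_squarefree_mul (hrt i ▸ (mem_G1.1 (hrG i)).2.1)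
  have htsq : ∀ i, Squarefree (t i) := fun i =>
    (mem_G1.1 (hrG i)).2.1.squarefree_of_dvd ⟨𝔲 i, by rw [mul_comm]; exact hrt i⟩
  have ht0 : ∀ i, t i ≠ ⊥ := fun i => by rw [Ne, ← Ideal.zero_eq_bot]; exact (htsq i).ne_zero
  have hφr : ∀ i, idealTotient K (𝔯 i) = idealTotient K (𝔲 i) * idealTotient K (t i) := fun i => by
    rw [hrt i, idealTotient_mul_of_coprime _ _ (hcop i)]
  have hφu : ∀ i, 0 < idealTotient K (𝔲 i) := fun i => idealTotient_pos_of_mem_G1 (huG i)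
  have hφt : ∀ i, 0 < idealTotient K (t i) := fun i => idealTotient_pos (ht0 i)
  -- termwise bounds
  have hc : ∀ i ∈ Finset.univ.erase m,
      |(if 𝔲 i ∣ 𝔯 i then hAF K (𝔲 i) * Vsum K (cof (𝔲 i) (𝔯 i)) else 0)| ≤
        ((Ideal.absNorm (𝔲 i) : ℝ) / idealTotient K (𝔲 i)) * (1 / idealTotient K (t i)) := by
    intro i _
    rw [if_pos (hdiv i), abs_mul, abs_hAF (mem_G1.1 (huG i)).2.1, abs_Vsum (htsq i)]
  have hP := abs_prefactor_eq h2 hu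
  rw [abs_mul, hP, abs_mul, abs_div, Finset.abs_prod]
  have hφabs : ∏ i, |idealTotient K (𝔯 i)| = ∏ i, idealTotient K (𝔲 i) * idealTotient K (t i) :=
    Finset.prod_congr rfl fun i _ => by
      rw [abs_of_pos (by rw [hφr i]; exact mul_pos (hφu i) (hφt i)), hφr i]
  rw [hφabs]
  have hg0 : 0 ≤ ∏ i, gId K (𝔲 i) := Finset.prod_nonneg fun i _ => (gId_pos_of_mem_G1 h2 (huG i)).le
  have hden0 : 0 ≤ ∏ i, idealTotient K (𝔲 i) * idealTotient K (t i) :=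
    Finset.prod_nonneg fun i _ => (mul_pos (hφu i) (hφt i)).le
  calc (∏ i, gId K (𝔲 i)) * (|y 𝔯| / (∏ i, idealTotient K (𝔲 i) * idealTotient K (t i)) *
        |∏ i ∈ Finset.univ.erase m,
          (if 𝔲 i ∣ 𝔯 i then hAF K (𝔲 i) * Vsum K (cof (𝔲 i) (𝔯 i)) else 0)|)
      ≤ (∏ i, gId K (𝔲 i)) * (ymax / (∏ i, idealTotient K (𝔲 i) * idealTotient K (t i)) *
        ∏ i ∈ Finset.univ.erase m,
          ((Ideal.absNorm (𝔲 i) : ℝ) / idealTotient K (𝔲 i)) * (1 / idealTotient K (t i))) := by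
        refine mul_le_mul_of_nonneg_left ?_ hg0
        refine mul_le_mul ?_ ?_ (abs_nonneg _) (div_nonneg hy0 hden0)
        · exact div_le_div_of_nonneg_right (hymax 𝔯) hden0
        · rw [Finset.abs_prod]
          exact Finset.prod_le_prod (fun i _ => abs_nonneg _) hc
    _ = ymax * kappa K 𝔲 * wfun m t := by
        rw [kappa, wfun, ← Finset.mul_prod_erase _ _ (Finset.mem_univ m),
          ← Finset.mul_prod_erase Finset.univ (fun i => idealTotient K (𝔲 i) * idealTotient K (t i))
            (Finset.mem_univ m),
          ← Finset.mul_prod_erase Finset.univ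
            (fun i => gId K (𝔲 i) * (Ideal.absNorm (𝔲 i) : ℝ) / idealTotient K (𝔲 i) ^ 2)
            (Finset.mem_univ m)]
        have htm : t m = 𝔯 m := by simp only [ht, hum]; exact cof_top _
        simp only [hum, gId_top, idealTotient_top, Ideal.absNorm_top, Nat.cast_one, one_mul, one_pow,
          div_one, mul_one]
        rw [htm]
        have key : ∀ i ∈ Finset.univ.erase m,
            gId K (𝔲 i) * (((Ideal.absNorm (𝔲 i) : ℝ) / idealTotient K (𝔲 i)) * (1 / idealTotient K (t i))) /
              (idealTotient K (𝔲 i) * idealTotient K (t i)) =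
            (gId K (𝔲 i) * (Ideal.absNorm (𝔲 i) : ℝ) / idealTotient K (𝔲 i) ^ 2) *
              (1 / idealTotient K (t i) ^ 2) := by
          intro i _
          have h1 := (hφu i).ne'
          have h2' := (hφt i).ne'
          field_simp
        have e1 : (∏ x ∈ Finset.univ.erase m, gId K (𝔲 x)) *
            (ymax / (idealTotient K (𝔯 m) *
              ∏ x ∈ Finset.univ.erase m, idealTotient K (𝔲 x) * idealTotient K (t x)) *
              ∏ i ∈ Finset.univ.erase m,
                (Ideal.absNorm (𝔲 i) : ℝ) / idealTotient K (𝔲 i) * (1 / idealTotient K (t i))) =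
            ymax * (1 / idealTotient K (𝔯 m)) *
              ((∏ x ∈ Finset.univ.erase m, gId K (𝔲 x)) *
                (∏ i ∈ Finset.univ.erase m,
                  (Ideal.absNorm (𝔲 i) : ℝ) / idealTotient K (𝔲 i) * (1 / idealTotient K (t i))) /
                ∏ x ∈ Finset.univ.erase m, idealTotient K (𝔲 x) * idealTotient K (t x)) := by
          ring
        rw [e1, ← Finset.prod_mul_distrib, ← Finset.prod_div_distrib, Finset.prod_congr rfl key,
          Finset.prod_mul_distrib]
        ring

/-- `w` as a product over all coordinates. [folklore] -/
theorem wfun_eq_prod (m : Fin k) (𝔱 : Fin k → Ideal (𝓞 K)) :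
    wfun (K := K) m 𝔱 =
      ∏ i, (if i = m then 1 / idealTotient K (𝔱 i) else 1 / idealTotient K (𝔱 i) ^ 2) := by
  rw [wfun, ← Finset.mul_prod_erase _ _ (Finset.mem_univ m), if_pos rfl]
  congr 1
  exact Finset.prod_congr rfl fun i hi => by rw [if_neg (Finset.mem_erase.1 hi).1]

/-- For `j ≠ m`: `∑_{𝔱 ∈ G1^k, 𝔱_j ≠ (1)} w(𝔱) ≤ L (Z − 1) Z^k` with `L = ∑_{G1} 1/φ`, `Z = ∑_{G1} 1/φ²`
(the `j`-th factor is `Z − 1`, the `m`-th is `L`, the others are `Z ≥ 1`). [cite: MaynardAnnals2015, (5.30)] -/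
theorem sum_wfun_filter_le (hB : 1 ≤ B) (m : Fin k) {j : Fin k} (hjm : j ≠ m) :
    ∑ 𝔱 ∈ (Fintype.piFinset fun _ : Fin k => G1 K 𝔴 B).filter (fun 𝔱 => 𝔱 j ≠ ⊤), wfun m 𝔱 ≤
      (∑ 𝔫 ∈ G1 K 𝔴 B, 1 / idealTotient K 𝔫) *
        ((∑ 𝔫 ∈ G1 K 𝔴 B, 1 / idealTotient K 𝔫 ^ 2 - 1) *
          (∑ 𝔫 ∈ G1 K 𝔴 B, 1 / idealTotient K 𝔫 ^ 2) ^ k) := by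
  obtain ⟨L, hL⟩ : ∃ x : ℝ, x = ∑ 𝔫 ∈ G1 K 𝔴 B, 1 / idealTotient K 𝔫 := ⟨_, rfl⟩
  obtain ⟨Z, hZ⟩ : ∃ x : ℝ, x = ∑ 𝔫 ∈ G1 K 𝔴 B, 1 / idealTotient K 𝔫 ^ 2 := ⟨_, rfl⟩
  rw [← hL, ← hZ]
  have h1G : (⊤ : Ideal (𝓞 K)) ∈ G1 K 𝔴 B := top_mem_G1 hB
  have hpos : ∀ 𝔫 ∈ G1 K 𝔴 B, 0 < idealTotient K 𝔫 := fun 𝔫 hn => idealTotient_pos_of_mem_G1 hn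
  have hL0 : 0 ≤ L := by
    rw [hL]; exact Finset.sum_nonneg fun 𝔫 hn => (one_div_pos.2 (hpos 𝔫 hn)).le
  have hZ1' : Z - 1 = ∑ 𝔫 ∈ (G1 K 𝔴 B).erase ⊤, 1 / idealTotient K 𝔫 ^ 2 := by
    rw [hZ, ← Finset.add_sum_erase _ _ h1G, idealTotient_top]; simp
  have hZ1 : 1 ≤ Z := by
    rw [← sub_nonneg, hZ1']
    exact Finset.sum_nonneg fun 𝔫 hn => by
      have := hpos 𝔫 (Finset.mem_erase.1 hn).2
      positivity
  -- the filtered box is a product box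
  have hset : (Fintype.piFinset fun _ : Fin k => G1 K 𝔴 B).filter (fun 𝔱 => 𝔱 j ≠ ⊤) =
      Fintype.piFinset fun i => if i = j then (G1 K 𝔴 B).erase ⊤ else G1 K 𝔴 B := by
    ext 𝔱
    simp only [Finset.mem_filter, Fintype.mem_piFinset]
    constructor
    · rintro ⟨h, hj⟩ i
      by_cases hi : i = j
      · subst hi; rw [if_pos rfl, Finset.mem_erase]; exact ⟨hj, h i⟩
      · rw [if_neg hi]; exact h i
    · intro h
      refine ⟨fun i => ?_, ?_⟩
      · have := h i
        by_cases hi : i = j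
        · subst hi; rw [if_pos rfl, Finset.mem_erase] at this; exact this.2
        · rwa [if_neg hi] at this
      · have := h j; rw [if_pos rfl, Finset.mem_erase] at this; exact this.1
  rw [hset]
  simp_rw [wfun_eq_prod]
  rw [← Finset.prod_univ_sum (fun i => if i = j then (G1 K 𝔴 B).erase ⊤ else G1 K 𝔴 B)
    (fun i 𝔫 => if i = m then 1 / idealTotient K 𝔫 else 1 / idealTotient K 𝔫 ^ 2)]
  have hfac : ∀ i, ∑ 𝔫 ∈ (if i = j then (G1 K 𝔴 B).erase ⊤ else G1 K 𝔴 B),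
      (if i = m then 1 / idealTotient K 𝔫 else 1 / idealTotient K 𝔫 ^ 2) =
      if i = m then L else if i = j then Z - 1 else Z := by
    intro i
    by_cases him : i = m
    · subst him
      simp only [↓reduceIte, hjm.symm, hL]
    · by_cases hij : i = j
      · subst hij
        simp only [↓reduceIte, him, hZ1']
      · simp only [him, hij, ↓reduceIte, hZ]
  simp_rw [hfac]
  rw [← Finset.mul_prod_erase _ _ (Finset.mem_univ m), if_pos rfl,
    ← Finset.mul_prod_erase _ _ (Finset.mem_erase.2 ⟨hjm, Finset.mem_univ j⟩), if_neg hjm, if_pos rfl]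
  refine mul_le_mul_of_nonneg_left (mul_le_mul_of_nonneg_left ?_ (by linarith)) hL0
  calc ∏ x ∈ (Finset.univ.erase m).erase j, (if x = m then L else if x = j then Z - 1 else Z)
      = ∏ x ∈ (Finset.univ.erase m).erase j, Z := by
        refine Finset.prod_congr rfl fun x hx => ?_
        rw [Finset.mem_erase, Finset.mem_erase] at hx
        rw [if_neg hx.2.1, if_neg hx.1]
    _ = Z ^ ((Finset.univ.erase m).erase j).card := Finset.prod_const Z
    _ ≤ Z ^ k := pow_le_pow_right₀ hZ1 (by
        calc ((Finset.univ.erase m).erase j).card ≤ (Finset.univ : Finset (Fin k)).card :=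
              Finset.card_le_card ((Finset.erase_subset _ _).trans (Finset.erase_subset _ _))
          _ = k := by rw [Finset.card_univ, Fintype.card_fin])

/-- Reindexing the error terms by `𝔱 = 𝔯/𝔲`: the total weight of the "rest" is at most
`∑_{j ≠ m} ∑_{𝔱 ∈ G1^k, 𝔱_j ≠ (1)} w(𝔱)`. [cite: MaynardAnnals2015, (5.30)] -/
theorem sum_rest_wfun_le {𝔲 : Fin k → Ideal (𝓞 K)} (hu : 𝔲 ∈ boxG K k 𝔴 B) :
    ∑ 𝔯 ∈ (boxG K k 𝔴 B).filter (fun 𝔯 => ¬∀ i, i ≠ m → 𝔯 i = 𝔲 i),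
        (if ∀ i, 𝔲 i ∣ 𝔯 i then wfun m (fun i => cof (𝔲 i) (𝔯 i)) else 0) ≤
      ∑ j ∈ Finset.univ.erase m,
        ∑ 𝔱 ∈ (Fintype.piFinset fun _ : Fin k => G1 K 𝔴 B).filter (fun 𝔱 => 𝔱 j ≠ ⊤), wfun m 𝔱 := by
  have huG := apply_mem_G1_of_mem_boxG hu
  rw [← Finset.sum_filter]
  have hinjOn : Set.InjOn (fun 𝔯 : Fin k → Ideal (𝓞 K) => fun i => cof (𝔲 i) (𝔯 i))
      ((((boxG K k 𝔴 B).filter (fun 𝔯 => ¬∀ i, i ≠ m → 𝔯 i = 𝔲 i)).filter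
        (fun 𝔯 => ∀ i, 𝔲 i ∣ 𝔯 i)) : Set (Fin k → Ideal (𝓞 K))) := by
    intro 𝔯 hr 𝔯' hr' h
    rw [Finset.mem_coe, Finset.mem_filter] at hr hr'
    funext i
    have h1 := congrFun h i
    simp only at h1
    rw [eq_mul_cof (hr.2 i), eq_mul_cof (hr'.2 i), h1]
  have hw0 : ∀ 𝔱 ∈ (Fintype.piFinset fun _ : Fin k => G1 K 𝔴 B), 0 ≤ wfun (K := K) m 𝔱 :=
    fun 𝔱 ht => wfun_nonneg m fun i => (mem_G1.1 (Fintype.mem_piFinset.1 ht i)).1.1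
  refine le_of_eq_of_le (Finset.sum_image (f := wfun m) hinjOn).symm ?_
  refine le_trans ?_ (MaynardSieve.sum_filter_exists_le (Finset.univ.erase m)
    (Fintype.piFinset fun _ : Fin k => G1 K 𝔴 B) (fun j 𝔱 => 𝔱 j ≠ ⊤) (wfun m) hw0)
  refine Finset.sum_le_sum_of_subset_of_nonneg (fun 𝔱 ht => ?_) fun 𝔱 ht _ =>
    hw0 𝔱 (Finset.mem_filter.1 ht).1
  rw [Finset.mem_image] at ht
  obtain ⟨𝔯, hr, rfl⟩ := ht
  rw [Finset.mem_filter, Finset.mem_filter] at hr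
  obtain ⟨⟨hrg, hne⟩, hdiv⟩ := hr
  rw [Finset.mem_filter, Fintype.mem_piFinset]
  refine ⟨fun i => mem_G1_of_dvd (apply_mem_G1_of_mem_boxG hrg i)
    ⟨𝔲 i, by rw [mul_comm]; exact eq_mul_cof (hdiv i)⟩, ?_⟩
  obtain ⟨j, hj⟩ := not_forall.1 hne
  obtain ⟨hjm, hrj⟩ := Classical.not_imp.1 hj
  refine ⟨j, Finset.mem_erase.2 ⟨hjm, Finset.mem_univ j⟩, fun h1 => hrj ?_⟩
  have h1' : cof (𝔲 j) (𝔯 j) = ⊤ := h1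
  have := eq_mul_cof (hdiv j)
  rw [h1', Ideal.mul_top] at this
  exact this

/-- **Lemma 2.4 (Castillo et al.) = Lemma 5.3 (Maynard)**: when the primes of norm `2` divide `𝔴`,
for `y` supported on good tuples of the box with `|y| ≤ y_max`, and a good `𝔲` with `𝔲_m = (1)`,
`|y^{(m)}_𝔲 − κ(𝔲) ∑_𝔞 y_{𝔲[m↦𝔞]}/φ(𝔞)| ≤ y_max κ(𝔲) · k L (Z − 1) Z^k`,
`L = ∑_{𝔫 ∈ G1} 1/φ(𝔫)`, `Z = ∑_{𝔫 ∈ G1} 1/φ(𝔫)²` (printed: `≪ y_max φ(𝔴) log R/(|𝔴| D₀)`, since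
`L ≪ φ(𝔴) log R/|𝔴|` and `Z − 1 ≪ D₀^{-1/2}`). [cite: CastilloEtAl2015, Lemma 2.4; MaynardAnnals2015, Lemma 5.3] -/
theorem abs_ym_sub_main_le (h2 : ∀ P : Ideal (𝓞 K), Prime P → Ideal.absNorm P = 2 → P ∣ 𝔴)
    (hy : SupportedOn K k 𝔴 B y) {ymax : ℝ} (hymax : ∀ 𝔯, |y 𝔯| ≤ ymax)
    {𝔲 : Fin k → Ideal (𝓞 K)} (hu : 𝔲 ∈ boxG K k 𝔴 B) (hum : 𝔲 m = ⊤) :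
    |ym K k 𝔴 B y m 𝔲 - kappa K 𝔲 * Mterm K B y m 𝔲| ≤
      ymax * kappa K 𝔲 * ((k : ℝ) * ((∑ 𝔫 ∈ G1 K 𝔴 B, 1 / idealTotient K 𝔫) *
        ((∑ 𝔫 ∈ G1 K 𝔴 B, 1 / idealTotient K 𝔫 ^ 2 - 1) *
          (∑ 𝔫 ∈ G1 K 𝔴 B, 1 / idealTotient K 𝔫 ^ 2) ^ k))) := by
  have hB : 1 ≤ B := by
    have := (mem_box_iff.1 (mem_boxG.1 hu).1 m).2
    rwa [hum, Ideal.absNorm_top, Nat.cast_one] at this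
  obtain ⟨L, hL⟩ : ∃ x : ℝ, x = ∑ 𝔫 ∈ G1 K 𝔴 B, 1 / idealTotient K 𝔫 := ⟨_, rfl⟩
  obtain ⟨Z, hZ⟩ : ∃ x : ℝ, x = ∑ 𝔫 ∈ G1 K 𝔴 B, 1 / idealTotient K 𝔫 ^ 2 := ⟨_, rfl⟩
  have hy0 : 0 ≤ ymax := le_trans (abs_nonneg _) (hymax 𝔲)
  have hκ := kappa_pos h2 hu
  have h1G : (⊤ : Ideal (𝓞 K)) ∈ G1 K 𝔴 B := top_mem_G1 hB
  have hpos : ∀ 𝔫 ∈ G1 K 𝔴 B, 0 < idealTotient K 𝔫 := fun 𝔫 hn => idealTotient_pos_of_mem_G1 hn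
  have hL0 : 0 ≤ L := by
    rw [hL]; exact Finset.sum_nonneg fun 𝔫 hn => (one_div_pos.2 (hpos 𝔫 hn)).le
  have hZ1 : 1 ≤ Z := by
    have hZ1' : Z - 1 = ∑ 𝔫 ∈ (G1 K 𝔴 B).erase ⊤, 1 / idealTotient K 𝔫 ^ 2 := by
      rw [hZ, ← Finset.add_sum_erase _ _ h1G, idealTotient_top]; simp
    rw [← sub_nonneg, hZ1']
    exact Finset.sum_nonneg fun 𝔫 hn => by
      have := hpos 𝔫 (Finset.mem_erase.1 hn).2
      positivity
  have hc0 : 0 ≤ L * ((Z - 1) * Z ^ k) := mul_nonneg hL0 (mul_nonneg (by linarith) (by positivity))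
  have hwf := fun j (hj : j ∈ Finset.univ.erase m) =>
    sum_wfun_filter_le (K := K) (𝔴 := 𝔴) hB m (Finset.mem_erase.1 hj).1
  rw [← hL, ← hZ] at hwf ⊢
  rw [ym_eq_sum hy hum]
  obtain ⟨P, hP⟩ : ∃ x : ℝ, x = ∏ i, (idealMoebius (𝔲 i) : ℝ) * gId K (𝔲 i) := ⟨_, rfl⟩
  obtain ⟨T, hT⟩ : ∃ f : (Fin k → Ideal (𝓞 K)) → ℝ, f = fun 𝔯 => (y 𝔯 / ∏ i, idealTotient K (𝔯 i)) *
    ∏ i ∈ Finset.univ.erase m,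
      (if 𝔲 i ∣ 𝔯 i then hAF K (𝔲 i) * Vsum K (cof (𝔲 i) (𝔯 i)) else 0) := ⟨_, rfl⟩
  have hmain := prefactor_mul_sum_main_eq hy hu hum (m := m)
  have hrest := fun 𝔯 (hr : 𝔯 ∈ boxG K k 𝔴 B) => abs_rest_term_le h2 hu hum hymax hr (m := m) (y := y)
  rw [← hP] at hmain hrest ⊢
  have hTr : ∀ 𝔯, (y 𝔯 / ∏ i, idealTotient K (𝔯 i)) *
      ∏ i ∈ Finset.univ.erase m,
        (if 𝔲 i ∣ 𝔯 i then hAF K (𝔲 i) * Vsum K (cof (𝔲 i) (𝔯 i)) else 0) = T 𝔯 := fun 𝔯 => by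
    rw [hT]
  simp only [hTr] at hmain hrest ⊢
  rw [← Finset.sum_filter_add_sum_filter_not (boxG K k 𝔴 B) (fun 𝔯 => ∀ i, i ≠ m → 𝔯 i = 𝔲 i) T,
    mul_add, hmain, add_sub_cancel_left, Finset.mul_sum]
  calc |∑ 𝔯 ∈ (boxG K k 𝔴 B).filter (fun 𝔯 => ¬∀ i, i ≠ m → 𝔯 i = 𝔲 i), P * T 𝔯|
      ≤ ∑ 𝔯 ∈ (boxG K k 𝔴 B).filter (fun 𝔯 => ¬∀ i, i ≠ m → 𝔯 i = 𝔲 i), |P * T 𝔯| :=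
        Finset.abs_sum_le_sum_abs _ _
    _ ≤ ∑ 𝔯 ∈ (boxG K k 𝔴 B).filter (fun 𝔯 => ¬∀ i, i ≠ m → 𝔯 i = 𝔲 i),
          ymax * kappa K 𝔲 * (if ∀ i, 𝔲 i ∣ 𝔯 i then wfun m (fun i => cof (𝔲 i) (𝔯 i)) else 0) :=
        Finset.sum_le_sum fun 𝔯 hr => hrest 𝔯 (Finset.mem_filter.1 hr).1
    _ = ymax * kappa K 𝔲 * ∑ 𝔯 ∈ (boxG K k 𝔴 B).filter (fun 𝔯 => ¬∀ i, i ≠ m → 𝔯 i = 𝔲 i),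
          (if ∀ i, 𝔲 i ∣ 𝔯 i then wfun m (fun i => cof (𝔲 i) (𝔯 i)) else 0) := by rw [Finset.mul_sum]
    _ ≤ ymax * kappa K 𝔲 * ∑ j ∈ Finset.univ.erase m,
          ∑ 𝔱 ∈ (Fintype.piFinset fun _ : Fin k => G1 K 𝔴 B).filter (fun 𝔱 => 𝔱 j ≠ ⊤), wfun m 𝔱 :=
        mul_le_mul_of_nonneg_left (sum_rest_wfun_le hu) (by positivity)
    _ ≤ ymax * kappa K 𝔲 * ∑ _j ∈ Finset.univ.erase m, L * ((Z - 1) * Z ^ k) :=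
        mul_le_mul_of_nonneg_left (Finset.sum_le_sum hwf) (by positivity)
    _ ≤ ymax * kappa K 𝔲 * ((k : ℝ) * (L * ((Z - 1) * Z ^ k))) := by
        refine mul_le_mul_of_nonneg_left ?_ (by positivity)
        rw [Finset.sum_const, nsmul_eq_mul]
        refine mul_le_mul_of_nonneg_right ?_ hc0
        have h := Finset.card_erase_le (s := (Finset.univ : Finset (Fin k))) (a := m)
        rw [Finset.card_univ, Fintype.card_fin] at h
        exact_mod_cast h

/-- `y^{(m)}_𝔲 = 0` unless `𝔲_m = (1)`. [cite: MaynardAnnals2015, after (5.24)] -/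
theorem ym_eq_zero_of_ne {𝔲 : Fin k → Ideal (𝓞 K)} (hum : 𝔲 m ≠ ⊤) : ym K k 𝔴 B y m 𝔲 = 0 := by
  rw [ym_def]
  refine mul_eq_zero_of_right _ (Finset.sum_eq_zero fun 𝔡 hd => ?_)
  rw [Finset.mem_filter] at hd
  rw [lamM_def, if_neg, zero_div]
  intro hdm
  have h := hd.2 m
  rw [hdm] at h
  exact hum (Ideal.isUnit_iff.1 (isUnit_of_dvd_one (by rwa [Ideal.one_eq_top])))

/-- `|∑_𝔞 y_{𝔲[m↦𝔞]}/φ(𝔞)| ≤ y_max L`. [folklore] -/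
theorem abs_Mterm_le (hy : SupportedOn K k 𝔴 B y) {ymax : ℝ} (hymax : ∀ 𝔯, |y 𝔯| ≤ ymax)
    (𝔲 : Fin k → Ideal (𝓞 K)) :
    |Mterm K B y m 𝔲| ≤ ymax * ∑ 𝔫 ∈ G1 K 𝔴 B, 1 / idealTotient K 𝔫 := by
  have hy0 : 0 ≤ ymax := le_trans (abs_nonneg _) (hymax 𝔲)
  rw [Mterm]
  have hφ0 : ∀ 𝔞 ∈ idealsLE K B, 0 < idealTotient K 𝔞 := fun 𝔞 ha => idealTotient_pos (mem_idealsLE.1 ha).1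
  calc |∑ 𝔞 ∈ idealsLE K B, y (Function.update 𝔲 m 𝔞) / idealTotient K 𝔞|
      ≤ ∑ 𝔞 ∈ idealsLE K B, |y (Function.update 𝔲 m 𝔞)| / idealTotient K 𝔞 := by
        refine (Finset.abs_sum_le_sum_abs _ _).trans (Finset.sum_le_sum fun 𝔞 ha => ?_)
        rw [abs_div, abs_of_pos (hφ0 𝔞 ha)]
    _ = ∑ 𝔞 ∈ G1 K 𝔴 B, |y (Function.update 𝔲 m 𝔞)| / idealTotient K 𝔞 := by
        symm
        refine Finset.sum_subset (fun 𝔞 ha => (Finset.mem_filter.1 ha).1) fun 𝔞 _ hna => ?_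
        have : y (Function.update 𝔲 m 𝔞) = 0 := by
          by_contra h
          have hg := (hy _ h).2
          have := apply_mem_G1_of_mem_boxG (mem_boxG.2 ⟨(hy _ h).1, hg⟩) m
          simp at this
          exact hna this
        rw [this, abs_zero, zero_div]
    _ ≤ ∑ 𝔞 ∈ G1 K 𝔴 B, ymax * (1 / idealTotient K 𝔞) := by
        refine Finset.sum_le_sum fun 𝔞 ha => ?_
        rw [mul_one_div]
        exact div_le_div_of_nonneg_right (hymax _) (idealTotient_pos_of_mem_G1 ha).le
    _ = ymax * ∑ 𝔫 ∈ G1 K 𝔴 B, 1 / idealTotient K 𝔫 := by rw [Finset.mul_sum]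

/-! ### The size of `κ(𝔲)` -/

/-- For a squarefree `𝔫`: `g(𝔫) N𝔫/φ(𝔫)² = ∏_{P ∣ 𝔫} (1 − 1/(NP−1)²)`. [cite: MaynardAnnals2015, end of proof of Lemma 5.3] -/
theorem gId_mul_div_sq_eq {𝔫 : Ideal (𝓞 K)} (hn : Squarefree 𝔫) :
    gId K 𝔫 * (Ideal.absNorm 𝔫 : ℝ) / idealTotient K 𝔫 ^ 2 =
      ∏ P ∈ (normalizedFactors 𝔫).toFinset, (1 - 1 / ((Ideal.absNorm P : ℝ) - 1) ^ 2) := by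
  have h𝔫0 : (𝔫 : Ideal (𝓞 K)) ≠ 0 := hn.ne_zero
  have h𝔫 : 𝔫 ≠ ⊥ := by rwa [Ne, ← Ideal.zero_eq_bot]
  have hnd := (squarefree_iff_nodup_normalizedFactors h𝔫0).1 hn
  have hcount : ∀ P ∈ (normalizedFactors 𝔫).toFinset, Multiset.count P (normalizedFactors 𝔫) = 1 := by
    intro P hP
    have := Multiset.nodup_iff_count_le_one.1 hnd P
    have := Multiset.one_le_count_iff_mem.2 (Multiset.mem_toFinset.1 hP)
    omega
  have hN : ((Ideal.absNorm 𝔫 : ℕ) : ℝ) = ∏ P ∈ (normalizedFactors 𝔫).toFinset, (Ideal.absNorm P : ℝ) := by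
    rw [Literature.NumberTheory.Sieve.IdealSieve.absNorm_eq_prod_pow h𝔫]
    exact Finset.prod_congr rfl fun P hP => by rw [hcount P hP, pow_one]
  rw [gId, idealTotient_of_squarefree hn, hN, ← Finset.prod_mul_distrib, ← Finset.prod_pow,
    ← Finset.prod_div_distrib]
  refine Finset.prod_congr rfl fun P hP => ?_
  have h2 : (2 : ℝ) ≤ Ideal.absNorm P := by
    exact_mod_cast two_le_absNorm_of_prime (prime_of_normalized_factor P (Multiset.mem_toFinset.1 hP))
  have : (Ideal.absNorm P : ℝ) - 1 ≠ 0 := by linarith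
  field_simp
  ring

/-- `κ(𝔲) ≤ 1` for tuples of squarefree ideals. [cite: MaynardAnnals2015, Lemma 5.3] -/
theorem kappa_le_one {𝔲 : Fin k → Ideal (𝓞 K)} (hu : 𝔲 ∈ boxG K k 𝔴 B) : kappa K 𝔲 ≤ 1 := by
  have huG := apply_mem_G1_of_mem_boxG hu
  unfold kappa
  refine Finset.prod_le_one (fun i _ => ?_) fun i _ => ?_
  · rw [gId_mul_div_sq_eq (mem_G1.1 (huG i)).2.1]
    refine Finset.prod_nonneg fun P hP => ?_
    have h2 : (2 : ℝ) ≤ Ideal.absNorm P := by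
      exact_mod_cast two_le_absNorm_of_prime (prime_of_normalized_factor P (Multiset.mem_toFinset.1 hP))
    have : 1 / ((Ideal.absNorm P : ℝ) - 1) ^ 2 ≤ 1 := by
      rw [div_le_one (by nlinarith)]; nlinarith
    linarith
  · rw [gId_mul_div_sq_eq (mem_G1.1 (huG i)).2.1]
    refine Finset.prod_le_one (fun P hP => ?_) fun P hP => ?_
    · have h2 : (2 : ℝ) ≤ Ideal.absNorm P := by
        exact_mod_cast two_le_absNorm_of_prime (prime_of_normalized_factor P (Multiset.mem_toFinset.1 hP))
      have : 1 / ((Ideal.absNorm P : ℝ) - 1) ^ 2 ≤ 1 := by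
        rw [div_le_one (by nlinarith)]; nlinarith
      linarith
    · have : 0 ≤ 1 / ((Ideal.absNorm P : ℝ) - 1) ^ 2 := by positivity
      linarith

end Literature.NumberTheory.Sieve.MaynardNF
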